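/- Copyright: ym3-torus cell, WIDTH seat `ym-ust-19936-w7` (prover, g9), for crux `HistoryTailL` (stmt-QuantumFields-19936),
level-0 infrastructure (T4-LOW, part 2) of LINE `local_insertion` (#13) ∕ K1.  Released under the licence of the surrounding project. -/
import Literature.MathematicalPhysics.QuantumFieldTheory.WilsonPlaquetteLargeFieldTail
import HarnessLib

/-!
# The hyperplane twist of the torus and the near-configuration bound on the Wilson action (every `d`)

Support file (`--supports stmt-QuantumFields-19936 --as helper`), second brick of «(T4) UNIFORM DOUBLING, general d» (LEAD ★w1-19936 g7
00:35:51Z (2) GO), general-`d` port of ✓`…LangevinControlUVFemtoCurvatureTwoPointCHyperplaneTwist` (route `LangevinControlUV`, `d = 4`,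
Frobenius norm) in the OPERATOR-norm letters of ✓`WilsonPlaquetteLargeFieldTail` (`‖ρ(·) − 1‖`, `open scoped Matrix.Norms.L2Operator`).

WHAT (torus `(ℤ/Lℤ)^d`, `GaugeConfig d L G`, unitary representation `ρ` on `ℂ^N`, Wilson action `S = Σ_p (N − Re tr ρ(U_p))`).
* §1 NEAR CONFIGURATIONS: `norm_rep_sub_rep_le` (`‖ρ g − ρ h‖ ≤ ‖ρ(h⁻¹g) − 1‖`), `norm_mul_sub_mul_le_of_norm_le_one`,
  `norm_plaquetteHolonomy_sub_le` (`‖ρ(U_p) − ρ(V_p)‖ ≤ 4δ` if every link is `δ`-close), ★ `wilsonAction_le_of_near`: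
  `‖ρ(U_e) − ρ(V_e)‖ ≤ δ ∀ e ⟹ S(U) ≤ 2N·S(V) + 16N δ²·#plaquettes`.
* §2 THE HYPERPLANE TWIST `Ū(a)` of an axis tuple `a : Fin d → G`: `Ū(a)(x, μ) = a_μ` if `(x_μ).val + 1 = L` (the wrap hyperplane of
  direction `μ`), `1` otherwise (spelled out, no definition).  `plaquetteHolonomy_twist`: every plaquette variable of `Ū(a)` is `1` or a
  commutator `a_μ a_ν a_μ⁻¹ a_ν⁻¹`, the latter exactly on the `L^{d−2}` plaquettes `(x; μ, ν)` with `x_μ = x_ν = L − 1`;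
  ★ `wilsonAction_twist_le`: `S(Ū(a)) ≤ L^{d−2} · S₁(a)`, `S₁(a) := wilsonAction ρ (L := 1) (fun e => a e.2)` = the commutator cost
  `Σ_{μ<ν} (N − Re tr ρ(a_μ a_ν a_μ⁻¹ a_ν⁻¹))` = the Wilson action of the ONE-SITE torus (`wilsonAction_oneSite_eq`).

WHY (brick 3, `lintegral_boltzmann_ge_axisHolonomy`): in the comb gauge the `d` axis wrap links carry the based axis holonomies `a`; every
other off-comb link `δ`-close to `Ū(a)` forces `S ≤ 2N L^{d−2} S₁(a) + 16Nδ²·#plaq`, and the law of `a` is Haar — whence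
`Z_L(b) ≥ e^{−16Nbδ²#plaq}·Haar(B_δ)^{#E_free − d}·Z₁(2N L^{d−2} b)`, the holonomy-conditioned lower half of the β-uniform torus doubling.

HONEST SCOPE.  Elementary matrix inequalities and a configuration count; nothing of LINE #13's stubs, of `HistoryTailL`, of any crux is
proved.  YM₃ on T³ is rung R3 — not d = 4, not infinite volume, not a mass gap, not Clay.  THEOREMS ONLY (0 `def`, 0 `sorry`); count-neutral.
-/

noncomputable section

open Finset Function
open scoped Matrix.Norms.L2Operator

namespace Summit.QuantumFields.YangMills.Theorems.LocalInsertion.TorusTwist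

open Literature.MathematicalPhysics.QuantumFieldTheory
open Literature.MathematicalPhysics.QuantumFieldTheory.Balaban1983to89.UnitaryModel
  (norm_of_mem_unitaryGroup)
open Literature.MathematicalPhysics.QuantumFieldTheory.PlaquetteTail
  (actionTerm_nonneg half_sq_le_actionTerm actionTerm_le_of_norm_le)

/-! ## §1 Near configurations have near actions -/

section Near

variable {m : ℕ} [NeZero m] {G : Type*} [Group G] (ρ : G →* Matrix (Fin m) (Fin m) ℂ)
  (hρu : ∀ g, ρ g ∈ Matrix.unitaryGroup (Fin m) ℂ)

include hρu in
/-- `‖ρ g‖ ≤ 1` along a unitary representation. [folklore] -/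
theorem norm_rep_le_one (g : G) : ‖ρ g‖ ≤ 1 := by
  haveI : Nonempty (Fin m) := ⟨⟨0, Nat.pos_of_ne_zero (NeZero.ne m)⟩⟩
  exact (norm_of_mem_unitaryGroup (hρu g)).le

include hρu in
/-- `‖ρ g − ρ h‖ ≤ ‖ρ(h⁻¹ g) − 1‖` (`ρ g − ρ h = ρ h · (ρ(h⁻¹g) − 1)`, `‖ρ h‖ = 1`). [cite: Balaban1985Averaging, (19) p.21] -/
theorem norm_rep_sub_rep_le (g h : G) : ‖ρ g - ρ h‖ ≤ ‖ρ (h⁻¹ * g) - 1‖ := by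
  have hcalc : ρ g - ρ h = ρ h * (ρ (h⁻¹ * g) - 1) := by
    rw [mul_sub, mul_one, ← map_mul, mul_inv_cancel_left]
  rw [hcalc]
  calc ‖ρ h * (ρ (h⁻¹ * g) - 1)‖ ≤ ‖ρ h‖ * ‖ρ (h⁻¹ * g) - 1‖ := norm_mul_le _ _
    _ ≤ 1 * ‖ρ (h⁻¹ * g) - 1‖ := by gcongr; exact norm_rep_le_one ρ hρu h
    _ = _ := one_mul _

omit [NeZero m] in
include hρu in
/-- `‖ρ(g⁻¹) − ρ(h⁻¹)‖ = ‖ρ g − ρ h‖` (inverses are adjoints). [folklore] -/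
theorem norm_rep_inv_sub_rep_inv (g h : G) : ‖ρ g⁻¹ - ρ h⁻¹‖ = ‖ρ g - ρ h‖ := by
  rw [map_inv_eq_conjTranspose ρ hρu, map_inv_eq_conjTranspose ρ hρu, ← Matrix.conjTranspose_sub,
    Matrix.l2_opNorm_conjTranspose]

omit [NeZero m] in
/-- `‖AB − A′B′‖ ≤ ‖A − A′‖ + ‖B − B′‖` when `‖A‖, ‖B′‖ ≤ 1`. [folklore] -/
theorem norm_mul_sub_mul_le_of_norm_le_one {A A' B B' : Matrix (Fin m) (Fin m) ℂ} (hA : ‖A‖ ≤ 1) (hB' : ‖B'‖ ≤ 1) :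
    ‖A * B - A' * B'‖ ≤ ‖A - A'‖ + ‖B - B'‖ := by
  have h : A * B - A' * B' = A * (B - B') + (A - A') * B' := by noncomm_ring
  rw [h]
  calc ‖A * (B - B') + (A - A') * B'‖ ≤ ‖A * (B - B')‖ + ‖(A - A') * B'‖ := norm_add_le _ _
    _ ≤ ‖A‖ * ‖B - B'‖ + ‖A - A'‖ * ‖B'‖ := add_le_add (norm_mul_le _ _) (norm_mul_le _ _)
    _ ≤ 1 * ‖B - B'‖ + ‖A - A'‖ * 1 := by gcongr
    _ = ‖A - A'‖ + ‖B - B'‖ := by ring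

include hρu in
/-- **Near links give near plaquette variables**: if `‖ρ(U_e) − ρ(V_e)‖ ≤ δ` on every edge then `‖ρ(U_p) − ρ(V_p)‖ ≤ 4δ`.
[cite: Balaban1985Averaging, (19) p.21] -/
theorem norm_plaquetteHolonomy_sub_le {d L : ℕ} {δ : ℝ} {U V : GaugeConfig d L G} (hUV : ∀ e, ‖ρ (U e) - ρ (V e)‖ ≤ δ)
    (x : Site d L) (i j : Fin d) : ‖ρ (plaquetteHolonomy U x i j) - ρ (plaquetteHolonomy V x i j)‖ ≤ 4 * δ := by
  have h1 := norm_rep_le_one ρ hρu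
  unfold plaquetteHolonomy
  simp only [map_mul]
  have hprod : ∀ g h : G, ‖ρ g * ρ h‖ ≤ 1 := fun g h => by rw [← map_mul]; exact h1 _
  have hprod3 : ∀ g h k : G, ‖ρ g * ρ h * ρ k‖ ≤ 1 := fun g h k => by rw [← map_mul, ← map_mul]; exact h1 _
  calc ‖ρ (U (x, i)) * ρ (U (x.shift i, j)) * ρ (U (x.shift j, i))⁻¹ * ρ (U (x, j))⁻¹ -
        ρ (V (x, i)) * ρ (V (x.shift i, j)) * ρ (V (x.shift j, i))⁻¹ * ρ (V (x, j))⁻¹‖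
      ≤ ‖ρ (U (x, i)) * ρ (U (x.shift i, j)) * ρ (U (x.shift j, i))⁻¹ -
          ρ (V (x, i)) * ρ (V (x.shift i, j)) * ρ (V (x.shift j, i))⁻¹‖ + ‖ρ (U (x, j))⁻¹ - ρ (V (x, j))⁻¹‖ :=
        norm_mul_sub_mul_le_of_norm_le_one (hprod3 _ _ _) (h1 _)
    _ ≤ ‖ρ (U (x, i)) * ρ (U (x.shift i, j)) - ρ (V (x, i)) * ρ (V (x.shift i, j))‖ +
          ‖ρ (U (x.shift j, i))⁻¹ - ρ (V (x.shift j, i))⁻¹‖ + ‖ρ (U (x, j))⁻¹ - ρ (V (x, j))⁻¹‖ := by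
        gcongr; exact norm_mul_sub_mul_le_of_norm_le_one (hprod _ _) (h1 _)
    _ ≤ ‖ρ (U (x, i)) - ρ (V (x, i))‖ + ‖ρ (U (x.shift i, j)) - ρ (V (x.shift i, j))‖ +
          ‖ρ (U (x.shift j, i))⁻¹ - ρ (V (x.shift j, i))⁻¹‖ + ‖ρ (U (x, j))⁻¹ - ρ (V (x, j))⁻¹‖ := by
        gcongr; exact norm_mul_sub_mul_le_of_norm_le_one (h1 _) (h1 _)
    _ ≤ δ + δ + δ + δ := by
        rw [norm_rep_inv_sub_rep_inv ρ hρu, norm_rep_inv_sub_rep_inv ρ hρu]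
        gcongr <;> exact hUV _
    _ = 4 * δ := by ring

include hρu in
/-- ★ **NEAR CONFIGURATIONS HAVE NEAR ACTIONS**: if `‖ρ(U_e) − ρ(V_e)‖ ≤ δ` on every edge, then
`S(U) ≤ 2N·S(V) + 16N·δ²·#plaquettes` (`N − Re tr ρ(W) ≤ N‖ρ W − 1‖²/2`, `‖ρ(U_p) − 1‖ ≤ 4δ + ‖ρ(V_p) − 1‖`,
`‖ρ(V_p) − 1‖²/2 ≤ N − Re tr ρ(V_p)`). [cite: Balaban1987RG1, (0.14) p.254] -/
theorem wilsonAction_le_of_near {d L : ℕ} [NeZero L] {δ : ℝ} {U V : GaugeConfig d L G}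
    (hUV : ∀ e, ‖ρ (U e) - ρ (V e)‖ ≤ δ) :
    wilsonAction ρ U ≤ 2 * m * wilsonAction ρ V + 16 * m * δ ^ 2 * Fintype.card (Plaquette d L) := by
  unfold wilsonAction
  have hterm : ∀ p : Plaquette d L,
      (m : ℝ) - (ρ (plaquetteHolonomy U p.1 p.2.1.1 p.2.1.2)).trace.re ≤
        2 * m * ((m : ℝ) - (ρ (plaquetteHolonomy V p.1 p.2.1.1 p.2.1.2)).trace.re) + 16 * m * δ ^ 2 := by
    intro p
    set t : ℝ := ‖ρ (plaquetteHolonomy V p.1 p.2.1.1 p.2.1.2) - 1‖ with ht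
    have ht0 : 0 ≤ t := norm_nonneg _
    have hnear := norm_plaquetteHolonomy_sub_le ρ hρu hUV p.1 p.2.1.1 p.2.1.2
    have hU1 : ‖ρ (plaquetteHolonomy U p.1 p.2.1.1 p.2.1.2) - 1‖ ≤ 4 * δ + t := by
      calc ‖ρ (plaquetteHolonomy U p.1 p.2.1.1 p.2.1.2) - 1‖
          = ‖(ρ (plaquetteHolonomy U p.1 p.2.1.1 p.2.1.2) - ρ (plaquetteHolonomy V p.1 p.2.1.1 p.2.1.2)) +
              (ρ (plaquetteHolonomy V p.1 p.2.1.1 p.2.1.2) - 1)‖ := by rw [sub_add_sub_cancel]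
        _ ≤ _ := (norm_add_le _ _).trans (add_le_add hnear le_rfl)
    have hup := actionTerm_le_of_norm_le ρ hρu hU1
    have hlow := half_sq_le_actionTerm ρ hρu ht0 (le_refl t)
    have hm : (0 : ℝ) ≤ m := Nat.cast_nonneg m
    have hδ : 0 ≤ 4 * δ := by
      have := (norm_nonneg _).trans (hUV ((fun _ => 0 : Fin d → ZMod L), ⟨0, Nat.pos_of_ne_zero ?_⟩))
      · linarith
      · rintro rfl; exact (IsEmpty.false p.2.1.1 : False)
    have hsq : (4 * δ + t) ^ 2 ≤ 2 * ((4 * δ) ^ 2 + t ^ 2) := by nlinarith [sq_nonneg (4 * δ - t)]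
    nlinarith
  calc ∑ p : Plaquette d L, ((m : ℝ) - (ρ (plaquetteHolonomy U p.1 p.2.1.1 p.2.1.2)).trace.re)
      ≤ ∑ p : Plaquette d L, (2 * m * ((m : ℝ) - (ρ (plaquetteHolonomy V p.1 p.2.1.1 p.2.1.2)).trace.re) + 16 * m * δ ^ 2) :=
        Finset.sum_le_sum fun p _ => hterm p
    _ = _ := by rw [Finset.sum_add_distrib, ← Finset.mul_sum, Finset.sum_const, Finset.card_univ, nsmul_eq_mul]; ring

end Near

/-! ## §2 The hyperplane twist -/

section Twist

variable {d L m : ℕ} [NeZero L] [NeZero m] {G : Type*} [Group G] (ρ : G →* Matrix (Fin m) (Fin m) ℂ)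
  (hρu : ∀ g, ρ g ∈ Matrix.unitaryGroup (Fin m) ℂ)

omit [NeZero L] [NeZero m] in
/-- **The plaquette variables of the hyperplane twist** `Ū(a)(x,μ) = a_μ·[(x_μ).val + 1 = L]`: for `μ ≠ ν`, `Ū(a)_{(x;μ,ν)}` is the
commutator `a_μ a_ν a_μ⁻¹ a_ν⁻¹` if `x_μ = x_ν = L − 1` and `1` otherwise. [folklore] -/
theorem plaquetteHolonomy_twist (a : Fin d → G) (x : Site d L) {i j : Fin d} (hij : i ≠ j) :
    plaquetteHolonomy (fun e : Edge d L => if (e.1 e.2).val + 1 = L then a e.2 else 1) x i j =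
      if (x i).val + 1 = L ∧ (x j).val + 1 = L then a i * a j * (a i)⁻¹ * (a j)⁻¹ else 1 := by
  unfold plaquetteHolonomy
  have hsi : (x.shift i) j = x j := by
    simp only [Site.shift, Pi.add_apply, Pi.single_eq_of_ne hij.symm, add_zero]
  have hsj : (x.shift j) i = x i := by
    simp only [Site.shift, Pi.add_apply, Pi.single_eq_of_ne hij, add_zero]
  simp only [hsi, hsj]
  by_cases hi : (x i).val + 1 = L <;> by_cases hj : (x j).val + 1 = L <;> simp [hi, hj]

omit [NeZero m] in
/-- On the one-site torus the plaquette variable of `(x, μ) ↦ a_μ` is the commutator. [folklore] -/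
theorem plaquetteHolonomy_oneSite (a : Fin d → G) (x : Site d 1) (i j : Fin d) :
    plaquetteHolonomy (fun e : Edge d 1 => a e.2) x i j = a i * a j * (a i)⁻¹ * (a j)⁻¹ := rfl

omit [NeZero m] in
/-- The Wilson action of the one-site torus is the commutator cost `Σ_{μ<ν} (N − Re tr ρ(a_μ a_ν a_μ⁻¹ a_ν⁻¹))`. [folklore] -/
theorem wilsonAction_oneSite_eq (a : Fin d → G) :
    wilsonAction ρ (fun e : Edge d 1 => a e.2) =
      ∑ q : {p : Fin d × Fin d // p.1 < p.2}, ((m : ℝ) - (ρ (a q.1.1 * a q.1.2 * (a q.1.1)⁻¹ * (a q.1.2)⁻¹)).trace.re) := by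
  unfold wilsonAction
  rw [Fintype.sum_prod_type, Fintype.sum_unique]
  rfl

omit [NeZero m] in
/-- At most `L^{d−2}` sites have two prescribed coordinates equal to a given value. [folklore] -/
theorem card_filter_two_coords_le {i j : Fin d} (hij : i ≠ j) (c : ZMod L) :
    #((Finset.univ : Finset (Site d L)).filter fun x => x i = c ∧ x j = c) ≤ L ^ (d - 2) := by
  classical
  rw [← Fintype.card_subtype]
  have hcard : Fintype.card ({k : Fin d // ¬ (k = i ∨ k = j)} → ZMod L) = L ^ (d - 2) := by
    rw [Fintype.card_fun, ZMod.card, Fintype.card_subtype_compl, Fintype.card_fin]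
    congr 1
    have : Fintype.card {k : Fin d // k = i ∨ k = j} = 2 := by
      rw [Fintype.card_subtype]
      have : (Finset.univ : Finset (Fin d)).filter (fun k => k = i ∨ k = j) = {i, j} := by
        ext k; simp
      rw [this, Finset.card_pair hij]
    omega
  rw [← hcard]
  refine Fintype.card_le_of_injective (fun x k => x.1 k.1) ?_
  rintro ⟨x, hx⟩ ⟨y, hy⟩ h
  refine Subtype.ext (funext fun k => ?_)
  show x k = y k
  by_cases hk : k = i ∨ k = j
  · rcases hk with rfl | rfl
    · rw [hx.1, hy.1]
    · rw [hx.2, hy.2]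
  · exact congr_fun h ⟨k, hk⟩

include hρu in
/-- ★ **THE ACTION OF THE HYPERPLANE TWIST**: `S(Ū(a)) ≤ L^{d−2} · S₁(a)`, `S₁(a)` the Wilson action of the one-site torus with links
`a` (the commutator cost; equality holds, the inequality is what the lower bound uses). [folklore] -/
theorem wilsonAction_twist_le (a : Fin d → G) :
    wilsonAction ρ (fun e : Edge d L => if (e.1 e.2).val + 1 = L then a e.2 else 1) ≤
      (L : ℝ) ^ (d - 2) * wilsonAction ρ (fun e : Edge d 1 => a e.2) := by
  classical
  rw [wilsonAction_oneSite_eq, Finset.mul_sum]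
  unfold wilsonAction
  rw [Fintype.sum_prod_type, Finset.sum_comm]
  refine Finset.sum_le_sum fun q _ => ?_
  have hq : q.1.1 ≠ q.1.2 := ne_of_lt q.2
  set cq : ℝ := (m : ℝ) - (ρ (a q.1.1 * a q.1.2 * (a q.1.1)⁻¹ * (a q.1.2)⁻¹)).trace.re with hcq
  have hcq0 : 0 ≤ cq := actionTerm_nonneg ρ hρu _
  have hterm : ∀ x : Site d L,
      (m : ℝ) - (ρ (plaquetteHolonomy (fun e : Edge d L => if (e.1 e.2).val + 1 = L then a e.2 else 1) x q.1.1 q.1.2)).trace.re =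
        if (x q.1.1).val + 1 = L ∧ (x q.1.2).val + 1 = L then cq else 0 := by
    intro x
    rw [plaquetteHolonomy_twist a x hq]
    split_ifs with h
    · rfl
    · rw [map_one, Matrix.trace_one, Fintype.card_fin]; simp
  show ∑ x : Site d L, ((m : ℝ) - (ρ (plaquetteHolonomy
      (fun e : Edge d L => if (e.1 e.2).val + 1 = L then a e.2 else 1) x q.1.1 q.1.2)).trace.re) ≤ (L : ℝ) ^ (d - 2) * cq
  simp only [hterm]
  rw [Finset.sum_ite, Finset.sum_const_zero, add_zero, Finset.sum_const, nsmul_eq_mul]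
  -- the count: `x_μ = x_ν = L − 1`
  have hL : 0 < L := Nat.pos_of_ne_zero (NeZero.ne L)
  have hset : (Finset.univ : Finset (Site d L)).filter (fun x => (x q.1.1).val + 1 = L ∧ (x q.1.2).val + 1 = L) =
      (Finset.univ : Finset (Site d L)).filter (fun x => x q.1.1 = ((L - 1 : ℕ) : ZMod L) ∧ x q.1.2 = ((L - 1 : ℕ) : ZMod L)) := by
    have key : ∀ z : ZMod L, z.val + 1 = L ↔ z = ((L - 1 : ℕ) : ZMod L) := fun z => by
      constructor
      · intro h
        have : z.val = L - 1 := by omega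
        rw [← ZMod.natCast_zmod_val z, this]
      · rintro rfl
        rw [ZMod.val_natCast, Nat.mod_eq_of_lt (by omega)]; omega
    ext x; simp only [Finset.mem_filter, Finset.mem_univ, true_and, key]
  rw [hset]
  have hcount := card_filter_two_coords_le hq ((L - 1 : ℕ) : ZMod L)
  calc (#((Finset.univ : Finset (Site d L)).filter fun x => x q.1.1 = ((L - 1 : ℕ) : ZMod L) ∧ x q.1.2 = ((L - 1 : ℕ) : ZMod L)) : ℝ) * cq
      ≤ (L : ℝ) ^ (d - 2) * cq := by
        refine mul_le_mul_of_nonneg_right ?_ hcq0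
        exact_mod_cast hcount

end Twist

end Summit.QuantumFields.YangMills.Theorems.LocalInsertion.TorusTwist

end
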